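import Summits.QuantumFields.YangMills.Theorems.BalabanUVNodesN09DomAltThresholdNull
import Summits.QuantumFields.YangMills.Theorems.BalabanUVNodesN11TkIteratedFibreReading
import Literature.MathematicalPhysics.QuantumFieldTheory.Balaban1983to89.Node00.TStepOfRecord

/-!
# NODE N09 · (F2) ON THE FIBRES OF THE AVERAGING OF RECORD — THE a.e.-IN-THE-COARSE-FIELD EDITION: for `dŪ`-almost every coarse field `V` the conditional
# law of the fine field given `Ū = V` gives ZERO mass to the fine threshold set `{U : ∃ p, |U(∂p) − 1| = ε₀}`; hence the transform of record `T_k` is blind,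
# `dV`-a.e., to how a density is cut AT the threshold (sharp `𝟙_{domAlt_k}` = closed-class cut-off = anything in between) — and exactly where (F1) begins

Cell `pub-ymgap` (YM-PLAN Track A), DAG node N09 [Balaban1987RG1] (= [I]); seat `pub-ymgap-dag-n09-w1` g4; count-neutral helper keyed to K1⁷
`stmt-QuantumFields-20542` (`--kind proof --supports … --as helper`).  HONEST FRAMING: kernel disintegration bookkeeping at NODE 00's definitions; NOTHING of
Bałaban's analysis asserted; N09 NOT discharged; K0⁷∕K1⁷ NOT closed; counts unmoved; one finite 𝕋⁴ programme at fixed ε — R4 closes the conditional rung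
`BalabanLadder.UV` only; the Yang–Mills mass gap (Clay) is NOT proved by any of this; nothing continuum ∕ ℝ⁴ ∕ OS.

THE LOCATED DEBT, FIBRE READING.  `pub-ymgap-node00-def-K0e/P7-LOCATOR-AUDIT.md` §4 (F2): «the SHARP `𝟙_{domAlt_k}` is integrated over fibres: for fixed `V₀` the
configurations … whose fibre point has a fine plaquette EXACTLY at threshold `ε₀` must be null».  The transform of record is the DISINTEGRATION kernel transport
`transportOfRecord F N K k = T4AveragingDisintegration.kernelTransport dU dV Ū` (def-T `Node00/TStepOfRecord`): `(T_kρ)(V) = h(V)·∫ ρ d(condLaw V)`.  This file reads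
the landed FULL-measure nullity (`…N09DomAltThresholdNull.fieldMeasure_thresholdSet_domAltOfRecord_eq_zero`, `dU{∃ p, |U(∂p) − 1| = ε₀} = 0`) through the
disintegration: a `dU`-null set is `condLaw(V)`-null for `dŪ`-ALMOST EVERY `V` (dag-n11-d's generic `BalabanUVNodesN11TkIteratedFibreReading.condLaw_null_ae`, BY NAME),
and two integrands agreeing on the fibre OFF a `dU`-null set have the same kernel transport at `dV`-almost every `V` (dag-n11-d's ★ AC-free
`kernelTransport_ae_congr_of_fibre_off_null`, BY NAME).  So the (F2) sentence holds at `dŪ`-∕`dV`-ALMOST EVERY coarse field `V₀`, for free.  What it does NOT give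
is the sentence AT EVERY `V₀` of the domain `domAlt_{k+1}` — that is continuity of `V ↦ condLaw V` across fibres, i.e. the Jacobian face (F1) of (0.4) (K0e
`F1-PROGRAMME-DESIGN.md`), untouched: the line between (F2) and (F1) is now kernel-exact.

WHAT IS PROVED (theorems only; 0 def; 0 sorry; axioms standard).  `F : T4Family`, `N` with `[NeZero N]`, `ν : Stage7Numerics` with `ν.ε₀ ≠ 0`, `K k : ℕ`;
`Ū := (avOfRecord F N K k).avg`, `dU := fieldMeasure (F.P K) k (SU N)`, `dV := fieldMeasure (F.P K) (k+1) (SU N)`.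
* §1 ★ `avgKernel_thresholdSet_null_ae` (`∀ᵐ V ∂(dU.map Ū), ∀ᵐ U ∂(avgKernel Ū V), ∀ p, |U(∂p) − 1| ≠ ε₀`), `avgKernel_frontier_domAltOfRecord_null_ae`.
* §2 ★★★ `transportOfRecord_ae_congr_off_thresholdSet` (`dV`-a.e. `V`: ANY two step-`k` densities agreeing on the fibre `{Ū = V}` off the threshold set have the same
  `transportOfRecord … V` — no absolute continuity, no integrability, every `k`), ★★ `transportOfRecord_chiFixAlt_mul_ae_eq_closure_indicator_mul` (sharp cut-off
  `chiFixAltOfRecord·ρ` and closed-class cut-off `𝟙_{closure domAlt_k}·ρ` have `dV`-a.e. equal transforms), `transportOfRecord_thresholdSet_indicator_mul_ae_eq_zero`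
  (a density living on the threshold set transforms to `0`, `dV`-a.e.).

HONEST SCOPE.  (i) a.e. in the coarse field ONLY; the everywhere-in-`V` edition (needed at each `V₀ ∈ domAlt_{k+1}` by `contTOn`) = (F1), NOT here; (F3) untouched; so
`hreg`∕`contTOn` stay DISPLAYED on every N09 door.  (ii) `ν.ε₀ ≠ 0` hypothesis as in the sibling file.  (iii) Nothing of dag-n11-d ∕ def-T ∕ pub-balaban pv07 is re-proved:
`condLaw_null_ae`, `kernelTransport_ae_congr_of_fibre_off_null`, `transportOfRecord`, `avOfRecord_measurable` are consumed BY NAME.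
-/

noncomputable section

open MeasureTheory Set Filter Topology
open Literature.MathematicalPhysics.QuantumFieldTheory
open Literature.MathematicalPhysics.QuantumFieldTheory.Balaban1983to89
open Literature.MathematicalPhysics.QuantumFieldTheory.Balaban1983to89.Node00
open Literature.MathematicalPhysics.QuantumFieldTheory.Balaban1983to89.T4Continuum (T4Family)
open Literature.MathematicalPhysics.QuantumFieldTheory.Balaban1983to89.T4AveragingDisintegration
  (kernelTransport condLaw avgKernel transportK)
open Summit.QuantumFields.YangMills.Theorems.BalabanUVNodesN11TkIteratedFibreReading (condLaw_null_ae kernelTransport_ae_congr_of_fibre_off_null)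
open Summit.QuantumFields.YangMills.BalabanUVNodes.N09DomAltThresholdNull
  (fieldMeasure_thresholdSet_domAltOfRecord_eq_zero fieldMeasure_frontier_domAltOfRecord_eq_zero frontier_domAltOfRecord_subset)

namespace Summit.QuantumFields.YangMills.BalabanUVNodes.N09FibreThresholdNullAE

variable (F : T4Family) (N : ℕ) [NeZero N]

/-! ## §1 The conditional law of the fine field given its block average is blind to the threshold set, `dŪ`-a.e. -/

/-- **★ FOR `dŪ`-ALMOST EVERY COARSE FIELD `V`, THE CONDITIONAL LAW OF THE FINE FIELD GIVEN `Ū = V` GIVES ZERO MASS TO THE FINE THRESHOLD SET**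
`{U : ∃ p, |U(∂p) − 1| = ν.ε₀}` (`ν.ε₀ ≠ 0`): the (F2) sentence of the P7 locator audit on the fibres of the averaging of record, a.e. in the coarse field
(`condLaw_null_ae` of dag-n11-d on FILE 3's full-measure nullity). [cite: Balaban1987RG1, p.259; Balaban1985Averaging, (10) p.19] -/
theorem avgKernel_thresholdSet_null_ae (ν : Stage7Numerics) (hε : ν.ε₀ ≠ 0) (K k : ℕ) :
    ∀ᵐ V ∂((fieldMeasure (F.P K) k (SU N)).map (avOfRecord F N K k).avg),
      ∀ᵐ U ∂(avgKernel (avOfRecord F N K k).avg V), ∀ p : Plaq (F.P K) k, dist1 (GaugeField.plaqHol U p) ≠ ν.ε₀ := by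
  have h := condLaw_null_ae (fieldMeasure (F.P K) k (SU N)) (avOfRecord_measurable F N K k)
    (fieldMeasure_thresholdSet_domAltOfRecord_eq_zero N F ν hε K k)
  filter_upwards [h] with V hV
  filter_upwards [hV] with U hU
  simpa only [Set.mem_setOf_eq, not_exists] using hU

/-- The same for the FRONTIER of the fine small-field domain `domAltOfRecord ν K k`: `condLaw(V)`-null for `dŪ`-a.e. `V`. [cite: Balaban1987RG1, p.259] -/
theorem avgKernel_frontier_domAltOfRecord_null_ae (ν : Stage7Numerics) (hε : ν.ε₀ ≠ 0) (K k : ℕ) :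
    ∀ᵐ V ∂((fieldMeasure (F.P K) k (SU N)).map (avOfRecord F N K k).avg),
      ∀ᵐ U ∂(avgKernel (avOfRecord F N K k).avg V), U ∉ frontier (domAltOfRecord F N ν K k) :=
  condLaw_null_ae (fieldMeasure (F.P K) k (SU N)) (avOfRecord_measurable F N K k)
    (fieldMeasure_frontier_domAltOfRecord_eq_zero N F ν hε K k)

/-! ## §2 The transform of record is blind, `dV`-a.e., to how a density is cut at the threshold -/

/-- `transportOfRecord` IS pub-balaban pv07's kernel transport along the averaging of record (definitional). [cite: Balaban1988Convergent, (3.1) p.264 (bookkeeping)] -/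
theorem transportOfRecord_eq_kernelTransport (K k : ℕ) (ρ : Density (F.P K) k (SU N)) :
    transportOfRecord F N K k ρ =
      kernelTransport (fieldMeasure (F.P K) k (SU N)) (fieldMeasure (F.P K) (k + 1) (SU N)) (avOfRecord F N K k).avg ρ := rfl

/-- **★★★ `dV`-A.E., THE TRANSFORM OF RECORD DOES NOT SEE THE FINE THRESHOLD SET**: for `dV`-almost every coarse field `V`, ANY two step-`k` densities that agree on
the fibre `{U | Ū = V}` at every `U` OFF the threshold set `{∃ p, |U(∂p) − 1| = ν.ε₀}` have the same transform of record at `V` (dag-n11-d's AC-free fibre reading off a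
null set, BY NAME; no integrability, no `HaarAC`, every `k`). [cite: Balaban1987RG1, p.259; Balaban1988Convergent, (3.1) p.264] -/
theorem transportOfRecord_ae_congr_off_thresholdSet (ν : Stage7Numerics) (hε : ν.ε₀ ≠ 0) (K k : ℕ) :
    ∀ᵐ V ∂fieldMeasure (F.P K) (k + 1) (SU N), ∀ ρ ρ' : Density (F.P K) k (SU N),
      (∀ U, (avOfRecord F N K k).avg U = V → (∀ p : Plaq (F.P K) k, dist1 (GaugeField.plaqHol U p) ≠ ν.ε₀) → ρ U = ρ' U) →
        transportOfRecord F N K k ρ V = transportOfRecord F N K k ρ' V := by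
  haveI : MeasurableEq (GaugeField (F.P K) (k + 1) (SU N)) := inferInstanceAs (MeasurableEq (PBond (F.P K) (k + 1) → SU N))
  have h := kernelTransport_ae_congr_of_fibre_off_null (fieldMeasure (F.P K) k (SU N)) (fieldMeasure (F.P K) (k + 1) (SU N))
    (avOfRecord_measurable F N K k) (fieldMeasure_thresholdSet_domAltOfRecord_eq_zero N F ν hε K k)
  filter_upwards [h] with V hV ρ ρ' hρ
  exact hV ρ ρ' fun U hU hUB => hρ U hU (by simpa only [Set.mem_setOf_eq, not_exists] using hUB)

/-- Off the threshold set, the sharp domain and its closure agree: `U ∉ {∃ p, |U(∂p) − 1| = ε₀} ⇒ (U ∈ domAlt ↔ U ∈ closure domAlt)`.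
[cite: Balaban1987RG1, p.259] -/
theorem mem_domAltOfRecord_iff_mem_closure_of_forall_ne (ν : Stage7Numerics) (K k : ℕ) {U : GaugeField (F.P K) k (SU N)}
    (hU : ∀ p : Plaq (F.P K) k, dist1 (GaugeField.plaqHol U p) ≠ ν.ε₀) :
    U ∈ domAltOfRecord F N ν K k ↔ U ∈ closure (domAltOfRecord F N ν K k) := by
  refine ⟨fun h => subset_closure h, fun h => ?_⟩
  by_contra hnot
  have hfr : U ∈ frontier (domAltOfRecord F N ν K k) := by
    rw [frontier_eq_closure_inter_closure]
    exact ⟨h, subset_closure hnot⟩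
  obtain ⟨p, hp⟩ := frontier_domAltOfRecord_subset N F ν K k hfr
  exact hU p hp

/-- **★★ SHARP CUT-OFF = CLOSED-CLASS CUT-OFF UNDER THE TRANSFORM, `dV`-a.e.**: for every density `ρ` of the step-`k` field,
`T_k(chiFixAltOfRecord·ρ) = T_k(𝟙_{closure domAlt_k}·ρ)` at `dV`-almost every coarse field (the two integrands differ only on the frontier ⊆ threshold set).
[cite: Balaban1987RG1, p.259; Balaban1988Convergent, (3.1) p.264] -/
theorem transportOfRecord_chiFixAlt_mul_ae_eq_closure_indicator_mul (ν : Stage7Numerics) (hε : ν.ε₀ ≠ 0) (K k : ℕ)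
    (ρ : Density (F.P K) k (SU N)) :
    (fun V => transportOfRecord F N K k (fun U => chiFixAltOfRecord F N ν K k U * ρ U) V) =ᵐ[fieldMeasure (F.P K) (k + 1) (SU N)]
      fun V => transportOfRecord F N K k (fun U => (closure (domAltOfRecord F N ν K k)).indicator (fun _ => (1 : ℝ)) U * ρ U) V := by
  filter_upwards [transportOfRecord_ae_congr_off_thresholdSet F N ν hε K k] with V hV
  refine hV _ _ fun U _ hUB => ?_
  rw [chiFixAltOfRecord_eq_indicator]
  by_cases hmem : U ∈ domAltOfRecord F N ν K k
  · rw [Set.indicator_of_mem hmem, Set.indicator_of_mem ((mem_domAltOfRecord_iff_mem_closure_of_forall_ne F N ν K k hUB).1 hmem)]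
    rfl
  · have hmem' : U ∉ closure (domAltOfRecord F N ν K k) := fun h => hmem ((mem_domAltOfRecord_iff_mem_closure_of_forall_ne F N ν K k hUB).2 h)
    rw [Set.indicator_of_notMem hmem, Set.indicator_of_notMem hmem']

/-- A density living on the threshold set transforms to `0`, `dV`-a.e. [cite: Balaban1987RG1, p.259; Balaban1988Convergent, (3.1) p.264] -/
theorem transportOfRecord_thresholdSet_indicator_mul_ae_eq_zero (ν : Stage7Numerics) (hε : ν.ε₀ ≠ 0) (K k : ℕ) (ρ : Density (F.P K) k (SU N)) :
    (fun V => transportOfRecord F N K k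
        (fun U => ({U : GaugeField (F.P K) k (SU N) | ∃ p : Plaq (F.P K) k, dist1 (GaugeField.plaqHol U p) = ν.ε₀}.indicator (fun _ => (1 : ℝ)) U) * ρ U) V)
      =ᵐ[fieldMeasure (F.P K) (k + 1) (SU N)] fun _ => 0 := by
  have h0 : ∀ V, transportOfRecord F N K k (fun _ => (0 : ℝ)) V = 0 := fun V => by
    rw [transportOfRecord_eq_kernelTransport]; simp [kernelTransport]
  filter_upwards [transportOfRecord_ae_congr_off_thresholdSet F N ν hε K k] with V hV
  rw [← h0 V]
  refine hV _ _ fun U _ hUB => ?_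
  have : U ∉ {U : GaugeField (F.P K) k (SU N) | ∃ p : Plaq (F.P K) k, dist1 (GaugeField.plaqHol U p) = ν.ε₀} := by
    simpa only [Set.mem_setOf_eq, not_exists] using hUB
  rw [Set.indicator_of_notMem this, zero_mul]

end Summit.QuantumFields.YangMills.BalabanUVNodes.N09FibreThresholdNullAE

end
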